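import Summits.ResolutionOfSingularities.ResolutionOfSingularities.Theorems.EquisingularLiftEquisingularLiftSingFiniteOfLeTwo
import Summits.ResolutionOfSingularities.ResolutionOfSingularities.Theorems.EquisingularLiftEquisingularLiftWittRing
import Summits.ResolutionOfSingularities.ResolutionOfSingularities.Theorems.EquisingularLiftEquisingularLiftProjectiveAmbientFibre
import Literature.AlgebraicGeometry.Resolution.AlterationsProofs
import Literature.AlgebraicGeometry.Resolution.Blowups
import HarnessLib

/-!
# [OURS · L1 W4.5(b)] EL♮ `EquisingularLiftNat` (stmt-ResolutionOfSingularities-20038), line `sections` — the REGULAR CASE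
# at the fixed model `ℙⁿ_𝕎(k)` and the degenerate cases `n ≤ 1` of the first rung `stub_elnat_le_two`

Helper file `--supports stmt-ResolutionOfSingularities-20038` (res-L1-w45b-plan-1 PORT-MAP-le_two Steps 4–5: «regular case —
re-derive its 5-line content for the fixed model: empty chain, special fibre irreducible, `V(Y) ≅ H` regular»; «n = 0, 1:
covered by the same proof (H regular or a point)»; tri-1 TRIAGE v3 (d): the degenerate cases are TRUE, not vacuous). NOT a
statement of any manuscript; OURS plumbing over the w45b toolkit.

* `isRegular_of_isClosedImmersion_projectiveSpace_of_le_one` — an integral closed subscheme `H ⊆ ℙⁿ_k` with `n ≤ 1` is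
  regular: either `ι` is onto, hence an isomorphism onto the regular `ℙⁿ_k` (`isRegular_projectiveSpace`), or `H` is a
  proper closed subset of the irreducible `ℙⁿ_k`, so `dim H < n ≤ 1` (`topologicalKrullDim_lt_of_isClosed_ssubset`), i.e.
  `H` is its generic point and its only local ring is the function field (`Scheme.IsRegular.of_topologicalKrullDim_le_zero`).
* `elnat_of_isRegular` — **the conclusion of `EquisingularLiftNat p` for a REGULAR `H`, any `n`**: the text of the registered
  stub `stub_elnat_le_two` with the binder `n ≤ 2` replaced by `Scheme.IsRegular H`. Proof: `O := 𝕎(k)` (`stub_wittRing`), and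
  for every graded `φ = MvPolynomial.map π` and `Y = range (ι ≫ Proj.map φ)` the EMPTY chain `(ℙⁿ_O, 𝟙, Y)`: the chain clause is
  its own base case; the special fibre of `ℙⁿ_O → Spec O` is irreducible (`stub_projectiveAmbientFibre`, same `q` verbatim);
  `Y` is closed (`Proj.map φ` is a closed immersion onto the special fibre, `ProjectiveAmbientFibre.isPullback_projMap`) and the
  reduced closed subscheme `V(Y)` is isomorphic to the reduced `H` (kernel of a closed immersion from a reduced scheme =
  vanishing ideal sheaf of its range — the argument of `equisingularLift_of_equisingularLiftNatA`), hence regular.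
* `elnat_le_one` — the stub text with `n ≤ 2` replaced by `n ≤ 1` (points of `ℙ⁰`, points of `ℙ¹`, `ℙ¹` itself), from the two
  lemmas above.

The rung holder (res-D-pv-022) closes `stub_elnat_le_two` by `elnat_of_isRegular` in the regular case and by the section
tower (E1 toolkit `…NatSectionStep`, p497593) for singular plane curves.
-/

set_option linter.dupNamespace false -- mandated namespace `Summit.<Summit>.<Problem>` of this single-conjunct summit

noncomputable section

open CategoryTheory CategoryTheory.Limits AlgebraicGeometry TopologicalSpace Topology
open MvPolynomial HomogeneousIdeal
open Literature.AlgebraicGeometry.Resolution Literature.AlgebraicGeometry.Motives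
open Summit.ResolutionOfSingularities.ResolutionOfSingularities.Cruxes.EquisingularLift.StrataSplit

universe u

namespace Summit.ResolutionOfSingularities.ResolutionOfSingularities.Cruxes.EquisingularLiftNat.Sections

/-! ## Integral closed subschemes of `ℙⁿ`, `n ≤ 1`, are regular -/

/-- `d < 1 → d ≤ 0` in `WithBot ℕ∞`. [folklore] -/
theorem withBotENat_le_zero_of_lt_one {d : WithBot ℕ∞} (h : d < (1 : ℕ)) : d ≤ 0 := by
  induction d using WithBot.recBotCoe with
  | bot => exact bot_le
  | coe e =>
    have h' : e < 1 := by
      have : (e : WithBot ℕ∞) < ((1 : ℕ∞) : WithBot ℕ∞) := by simpa using h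
      exact WithBot.coe_lt_coe.mp this
    have h0 : e = 0 := Order.lt_one_iff.mp h'
    subst h0
    exact le_rfl

/-- **An integral closed subscheme of `ℙⁿ_k`, `n ≤ 1`, is regular** (a `k`-point of `ℙ⁰` or `ℙ¹`, or `ℙ¹` itself): if the
closed immersion `ι` is onto it is an isomorphism onto the regular scheme `ℙⁿ_k`; otherwise `H` is a proper closed subset of
the irreducible `n`-dimensional `ℙⁿ_k`, so `dim H < n ≤ 1`, `H` is reduced to its generic point, and its only local ring is
the function field. [folklore] -/
theorem isRegular_of_isClosedImmersion_projectiveSpace_of_le_one {k : Type u} [Field k] {n : ℕ} {H : Scheme.{u}}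
    [IsIntegral H] (ι : H ⟶ (projectiveSpace n k).left) [IsClosedImmersion ι] (hn : n ≤ 1) :
    Scheme.IsRegular H := by
  -- adapted from `isIso_of_isClosedImmersion_projectiveSpace_of_not_dim_le_one` (…SingFiniteOfLeTwo.lean)
  haveI hint : IsIntegral (projectiveSpace n k).left := isIntegral_projectiveSpace n k
  by_cases hrange : Set.range ι.base = Set.univ
  · haveI : Surjective ι := ⟨Set.range_eq_univ.mp hrange⟩
    haveI : IsIso ι := isIso_of_isClosedImmersion_of_surjective ι
    exact Scheme.IsRegular.of_iso (inv ι) (isRegular_projectiveSpace n k)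
  · haveI : SmoothOfRelativeDimension n (projectiveSpace n k).hom :=
      (isSmoothProjective_projectiveSpace_holds k n).smoothOfRelativeDimension
    have hdimP : topologicalKrullDim ↥(projectiveSpace n k).left = (n : ℕ) :=
      topologicalKrullDim_eq_of_smoothOfRelativeDimension (projectiveSpace n k).hom n
    have hcl : IsClosed (Set.range ι.base) := ι.isClosedEmbedding.isClosed_range
    have hP : topologicalKrullDim ↥(projectiveSpace n k).left < (n + 1 : ℕ) := by
      rw [hdimP]
      exact_mod_cast Nat.lt_succ_self n
    have hlt := Literature.Topology.topologicalKrullDim_lt_of_isClosed_ssubset hcl hrange n hP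
    have heq : topologicalKrullDim H = topologicalKrullDim (Set.range ι.base) :=
      IsHomeomorph.topologicalKrullDim_eq _ ι.isClosedEmbedding.isEmbedding.toHomeomorph.isHomeomorph
    have hlt' : topologicalKrullDim H < (1 : ℕ) := by
      rw [heq]
      refine lt_of_lt_of_le hlt ?_
      exact_mod_cast hn
    exact Scheme.IsRegular.of_topologicalKrullDim_le_zero (withBotENat_le_zero_of_lt_one hlt')

/-! ## The regular case of EL♮ at the fixed model -/

/-- **EL♮ for a REGULAR `H` (any `n`)** — the registered stub `stub_elnat_le_two` with `n ≤ 2` replaced by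
`Scheme.IsRegular H`: take `O := 𝕎(k)` and, for every graded `φ = MvPolynomial.map π` and `Y = range (ι ≫ Proj.map φ)`, the
empty chain `(ℙⁿ_O, 𝟙, Y)`; the special fibre of `ℙⁿ_O` is irreducible and `V(Y)_red ≅ H` is regular. [folklore] -/
theorem elnat_of_isRegular (p : ℕ) : p.Prime → ∀ (k : Type) [Field k] [CharP k p] [IsAlgClosed k] (n : ℕ) (H : AlgebraicGeometry.Scheme.{0}) (ι : H ⟶ (Literature.AlgebraicGeometry.Motives.projectiveSpace n k).left), AlgebraicGeometry.IsClosedImmersion ι → AlgebraicGeometry.IsIntegral H → (∀ y : (Literature.AlgebraicGeometry.Motives.projectiveSpace n k).left, ∃ U : (Literature.AlgebraicGeometry.Motives.projectiveSpace n k).left.affineOpens, y ∈ (U : (Literature.AlgebraicGeometry.Motives.projectiveSpace n k).left.Opens) ∧ (ι.ker.ideal U).IsPrincipal) → Literature.AlgebraicGeometry.Resolution.Scheme.IsRegular H → ∃ (O : Type) (_ : CommRing O) (_ : IsDomain O) (_ : IsDiscreteValuationRing O) (_ : CharZero O) (π : O →+* k), Function.Surjective π ∧ (letI := MvPolynomial.gradedAlgebra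 (σ := Fin (n + 1)) (R := O); letI := MvPolynomial.gradedAlgebra (σ := Fin (n + 1)) (R := k); ∀ (φ : MvPolynomial.homogeneousSubmodule (Fin (n + 1)) O →+*ᵍ MvPolynomial.homogeneousSubmodule (Fin (n + 1)) k) (hφ' : HomogeneousIdeal.irrelevant (MvPolynomial.homogeneousSubmodule (Fin (n + 1)) k) ≤ (HomogeneousIdeal.irrelevant (MvPolynomial.homogeneousSubmodule (Fin (n + 1)) O)).map φ), (∀ s, φ s = MvPolynomial.map π s) → ∀ Y : Set (AlgebraicGeometry.Proj (MvPolynomial.homogeneousSubmodule (Fin (n + 1)) O)), Y = Set.range (CategoryTheory.CategoryStruct.comp ι (AlgebraicGeometry.Proj.map φ hφ') : H ⟶ (AlgebraicGeometry.Proj (MvPolynomial.homogeneousSubmodule (Fin (n + 1)) O))) → ∃ (P' : AlgebraicGeometry.Scheme.{0}) (σ : P' ⟶ (AlgebraicGeometry.Proj (MvPolynomial.homogeneousSubmodule (Fin (n + 1)) O))) (S' : Set P'), (∀ Q : (∀ X' : AlgebraicGeometry.Scheme.{0}, (X' ⟶ (AlgebraicGeometry.Proj (MvPolynomial.homogeneousSubmodule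 (Fin (n + 1)) O))) → Set X' → Prop), Q (AlgebraicGeometry.Proj (MvPolynomial.homogeneousSubmodule (Fin (n + 1)) O)) (CategoryTheory.CategoryStruct.id _) Y → (∀ (X' X'' : AlgebraicGeometry.Scheme.{0}) (σ' : X' ⟶ (AlgebraicGeometry.Proj (MvPolynomial.homogeneousSubmodule (Fin (n + 1)) O))) (Y' : Set X') (C : X'.IdealSheafData) (τ : X'' ⟶ X'), Q X' σ' Y' → Literature.AlgebraicGeometry.Resolution.IsBlowup τ C → Literature.AlgebraicGeometry.Resolution.Scheme.IsRegular C.subscheme → σ' '' (C.support : Set X') ⊆ {x | ¬ IsGenericPoint x Y} → (C.support : Set X') ∩ (CategoryTheory.CategoryStruct.comp σ' (CategoryTheory.CategoryStruct.comp (AlgebraicGeometry.Proj.toSpecZero (MvPolynomial.homogeneousSubmodule (Fin (n + 1)) O)) (AlgebraicGeometry.Spec.map (CommRingCat.ofHom (algebraMap O (MvPolynomial.homogeneousSubmodule (Fin (n + 1)) O 0)))))) ⁻¹' {IsLocalRing.closedPoint O} ⊆ Y' → Q X'' (CategoryTheory.CategoryStruct.comp τ σ') (closure (τ ⁻¹'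 (Y' \ (C.support : Set X'))))) → Q P' σ S') ∧ IsIrreducible ((CategoryTheory.CategoryStruct.comp σ (CategoryTheory.CategoryStruct.comp (AlgebraicGeometry.Proj.toSpecZero (MvPolynomial.homogeneousSubmodule (Fin (n + 1)) O)) (AlgebraicGeometry.Spec.map (CommRingCat.ofHom (algebraMap O (MvPolynomial.homogeneousSubmodule (Fin (n + 1)) O 0)))))) ⁻¹' {IsLocalRing.closedPoint O}) ∧ Literature.AlgebraicGeometry.Resolution.Scheme.IsRegular (AlgebraicGeometry.Scheme.IdealSheafData.vanishingIdeal (⟨closure S', isClosed_closure⟩ : TopologicalSpace.Closeds P')).subscheme) := by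
  intro hp k _ _ _ n H ι hι hH _hloc hHreg
  obtain ⟨O, i1, i2, i3, i4, _i5, _i6, π, hπ⟩ := stub_wittRing p hp k
  refine ⟨O, i1, i2, i3, i4, π, hπ, ?_⟩
  -- the gradings by degree (Mathlib abbrevs, not instances; the statement carries them as `letI`)
  letI := MvPolynomial.gradedAlgebra (σ := Fin (n + 1)) (R := O)
  letI := MvPolynomial.gradedAlgebra (σ := Fin (n + 1)) (R := k)
  intro φ hφ' hφ Y hY
  -- the comparison `g = Proj.map φ : ℙⁿ_k ⟶ ℙⁿ_O` is a closed immersion onto the special fibre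
  have hP := ProjectiveAmbientFibre.isPullback_projMap π φ hφ hπ hφ'
  set g : Proj (homogeneousSubmodule (Fin (n + 1)) k) ⟶ Proj (homogeneousSubmodule (Fin (n + 1)) O) :=
    Proj.map φ hφ' with hg
  haveI : IsClosedImmersion (Spec.map (CommRingCat.ofHom π)) := IsClosedImmersion.spec_of_surjective _ hπ
  haveI : IsClosedImmersion g := MorphismProperty.IsStableUnderBaseChange.of_isPullback hP.flip inferInstance
  haveI := hH
  let ι' : H ⟶ Proj (homogeneousSubmodule (Fin (n + 1)) k) := ι
  haveI : IsClosedImmersion ι' := hι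
  let f : H ⟶ Proj (homogeneousSubmodule (Fin (n + 1)) O) := ι' ≫ g
  have hYf : Y = Set.range f := hY
  -- the EMPTY chain at the fixed model
  refine ⟨Proj (homogeneousSubmodule (Fin (n + 1)) O), 𝟙 _, Y, fun Q h0 _ => h0, ?_, ?_⟩
  · -- the special fibre of `ℙⁿ_O → Spec O` is irreducible (`stub_projectiveAmbientFibre`, same `q` verbatim)
    obtain ⟨-, -, -, hirr⟩ := stub_projectiveAmbientFibre O k π hπ n H ι hι hH
    simpa only [Category.id_comp] using hirr
  · -- `V(Y)_red ≅ H` is regular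
    have hcl : closure Y = Set.range f := by rw [hYf]; exact f.isClosedEmbedding.isClosed_range.closure_eq
    have hYc : (⟨closure Y, isClosed_closure⟩ : Closeds (Proj (homogeneousSubmodule (Fin (n + 1)) O))) =
        ⟨Set.range f, f.isClosedEmbedding.isClosed_range⟩ := Closeds.ext hcl
    rw [hYc]
    -- adapted from `equisingularLift_of_equisingularLiftNatA` (…CampaignW45bEquisingularLiftNatInstantiation.lean)
    have hYker : Scheme.IdealSheafData.vanishingIdeal
        (⟨Set.range f, f.isClosedEmbedding.isClosed_range⟩ : Closeds (Proj (homogeneousSubmodule (Fin (n + 1)) O))) =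
          f.ker := by
      rw [← Scheme.IdealSheafData.map_bot, ← Scheme.nilradical_eq_bot, ← Scheme.IdealSheafData.vanishingIdeal_top,
        Scheme.IdealSheafData.map_vanishingIdeal]
      congr 1
      ext1
      change Set.range f = closure (f '' Set.univ)
      rw [Set.image_univ, f.isClosedEmbedding.isClosed_range.closure_eq]
    have hker : (Scheme.IdealSheafData.vanishingIdeal
        (⟨Set.range f, f.isClosedEmbedding.isClosed_range⟩ :
          Closeds (Proj (homogeneousSubmodule (Fin (n + 1)) O)))).subschemeι.ker = f.ker := by
      rw [Scheme.IdealSheafData.ker_subschemeι, hYker]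
    haveI := IsClosedImmersion.isIso_lift _ f hker
    exact Scheme.IsRegular.of_iso (IsClosedImmersion.lift _ f hker.le) hHreg

/-! ## The degenerate cases `n ≤ 1` -/

/-- **EL♮ for `n ≤ 1`** — the registered stub `stub_elnat_le_two` with `n ≤ 2` replaced by `n ≤ 1` (a point of `ℙ⁰` or `ℙ¹`,
or `ℙ¹` itself): such an `H` is regular (`isRegular_of_isClosedImmersion_projectiveSpace_of_le_one`), so `elnat_of_isRegular`
applies; the hypersurface and characteristic hypotheses are not used. [folklore] -/
theorem elnat_le_one (p : ℕ) : p.Prime → ∀ (k : Type) [Field k] [CharP k p] [IsAlgClosed k] (n : ℕ) (H : AlgebraicGeometry.Scheme.{0}) (ι : H ⟶ (Literature.AlgebraicGeometry.Motives.projectiveSpace n k).left), AlgebraicGeometry.IsClosedImmersion ι → AlgebraicGeometry.IsIntegral H → (∀ y : (Literature.AlgebraicGeometry.Motives.projectiveSpace n k).left, ∃ U : (Literature.AlgebraicGeometry.Motives.projectiveSpace n k).left.affineOpens, y ∈ (U : (Literature.AlgebraicGeometry.Motives.projectiveSpace n k).left.Opens) ∧ (ι.ker.ideal U).IsPrincipal)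 → n ≤ 1 → ∃ (O : Type) (_ : CommRing O) (_ : IsDomain O) (_ : IsDiscreteValuationRing O) (_ : CharZero O) (π : O →+* k), Function.Surjective π ∧ (letI := MvPolynomial.gradedAlgebra (σ := Fin (n + 1)) (R := O); letI := MvPolynomial.gradedAlgebra (σ := Fin (n + 1)) (R := k); ∀ (φ : MvPolynomial.homogeneousSubmodule (Fin (n + 1)) O →+*ᵍ MvPolynomial.homogeneousSubmodule (Fin (n + 1)) k) (hφ' : HomogeneousIdeal.irrelevant (MvPolynomial.homogeneousSubmodule (Fin (n + 1)) k) ≤ (HomogeneousIdeal.irrelevant (MvPolynomial.homogeneousSubmodule (Fin (n + 1)) O)).map φ), (∀ s, φ s = MvPolynomial.map π s) → ∀ Y : Set (AlgebraicGeometry.Proj (MvPolynomial.homogeneousSubmodule (Fin (n + 1)) O)), Y = Set.range (CategoryTheory.CategoryStruct.comp ι (AlgebraicGeometry.Proj.map φ hφ') : H ⟶ (AlgebraicGeometry.Proj (MvPolynomial.homogeneousSubmodule (Fin (n + 1)) O))) → ∃ (P' : AlgebraicGeometry.Scheme.{0}) (σ : P' ⟶ (AlgebraicGeometry.Proj (MvPolynomial.homogeneousSubmodule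 (Fin (n + 1)) O))) (S' : Set P'), (∀ Q : (∀ X' : AlgebraicGeometry.Scheme.{0}, (X' ⟶ (AlgebraicGeometry.Proj (MvPolynomial.homogeneousSubmodule (Fin (n + 1)) O))) → Set X' → Prop), Q (AlgebraicGeometry.Proj (MvPolynomial.homogeneousSubmodule (Fin (n + 1)) O)) (CategoryTheory.CategoryStruct.id _) Y → (∀ (X' X'' : AlgebraicGeometry.Scheme.{0}) (σ' : X' ⟶ (AlgebraicGeometry.Proj (MvPolynomial.homogeneousSubmodule (Fin (n + 1)) O))) (Y' : Set X') (C : X'.IdealSheafData) (τ : X'' ⟶ X'), Q X' σ' Y' → Literature.AlgebraicGeometry.Resolution.IsBlowup τ C → Literature.AlgebraicGeometry.Resolution.Scheme.IsRegular C.subscheme → σ' '' (C.support : Set X') ⊆ {x | ¬ IsGenericPoint x Y} → (C.support : Set X') ∩ (CategoryTheory.CategoryStruct.comp σ' (CategoryTheory.CategoryStruct.comp (AlgebraicGeometry.Proj.toSpecZero (MvPolynomial.homogeneousSubmodule (Fin (n + 1)) O)) (AlgebraicGeometry.Spec.map (CommRingCat.ofHom (algebraMap O (MvPolynomial.homogeneousSubmodule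 (Fin (n + 1)) O 0)))))) ⁻¹' {IsLocalRing.closedPoint O} ⊆ Y' → Q X'' (CategoryTheory.CategoryStruct.comp τ σ') (closure (τ ⁻¹' (Y' \ (C.support : Set X'))))) → Q P' σ S') ∧ IsIrreducible ((CategoryTheory.CategoryStruct.comp σ (CategoryTheory.CategoryStruct.comp (AlgebraicGeometry.Proj.toSpecZero (MvPolynomial.homogeneousSubmodule (Fin (n + 1)) O)) (AlgebraicGeometry.Spec.map (CommRingCat.ofHom (algebraMap O (MvPolynomial.homogeneousSubmodule (Fin (n + 1)) O 0)))))) ⁻¹' {IsLocalRing.closedPoint O}) ∧ Literature.AlgebraicGeometry.Resolution.Scheme.IsRegular (AlgebraicGeometry.Scheme.IdealSheafData.vanishingIdeal (⟨closure S', isClosed_closure⟩ : TopologicalSpace.Closeds P')).subscheme) := by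
  intro hp k _ _ _ n H ι hι hH hloc hn
  haveI := hH
  haveI := hι
  exact elnat_of_isRegular p hp k n H ι hι hH hloc (isRegular_of_isClosedImmersion_projectiveSpace_of_le_one ι hn)

end Summit.ResolutionOfSingularities.ResolutionOfSingularities.Cruxes.EquisingularLiftNat.Sections

end
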